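import Mathlib
import Summits.Schanuel.Schanuel.Theorems.SoloInformedExpAutomorphismDoor

/-!
# Exponential polynomials on `ℕ` and shear–twist orbits

Soloist seat `solo-Schanuel-informed`, session 9 (atlas §2 E11 / door (F)); the algebraic engine of
part III of the automorphism door (`SoloInformedExpAutomorphismDoorTwist`).

1. **Exponential polynomials** (`expPoly_eq_zero`): if `∑ⱼ pⱼ(k) λⱼ^k = 0` for all `k ∈ ℕ`, with
   pairwise distinct non-zero `λⱼ ∈ ℂ` and `pⱼ ∈ ℂ[T]`, then every `pⱼ = 0` (finite differences).
2. **Orbit lemma** (`aeval_line_eq_zero_of_shear_twist_orbit`): a rational polynomial vanishing at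
   the shear–twist orbit `(u^k y, x + k a)`, `k ∈ ℕ` (`y ≠ 0`, `u` of infinite order, `a` arbitrary,
   possibly `0`) vanishes on the whole line `ℂ × {x}`; hence (`algebraicIndependent_of_shear_twist`)
   if a ring endomorphism `φ` of `ℂ` shears `x ↦ x + a` and twists `y ↦ u·y` (`a, u` fixed by `φ`,
   `u` of infinite order), then `y, x` are algebraically independent as soon as `x` has one
   algebraically independent partner.

[folklore: linear recurrences / exponential polynomials; this file]
-/

noncomputable section

open Complex Polynomial

namespace Summit.Schanuel.Schanuel.Theorems


/-! ### 1. Exponential polynomials on `ℕ` with distinct frequencies -/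

/-- **Exponential polynomials with distinct non-zero frequencies vanish only trivially**: if
`∑ j, pⱼ(k) · λⱼ^k = 0` for every `k ∈ ℕ` then every `pⱼ = 0`. Proof by finite differences:
`f(k+1) - λ_{j₀} f(k)` lowers the degree of `p_{j₀}` and keeps the others. [folklore] -/
theorem expPoly_eq_zero {n : ℕ} {lam : Fin n → ℂ} (hinj : Function.Injective lam)
    (h0 : ∀ j, lam j ≠ 0) (p : Fin n → ℂ[X])
    (h : ∀ k : ℕ, ∑ j, (p j).eval (k : ℂ) * lam j ^ k = 0) : ∀ j, p j = 0 := by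
  classical
  suffices H : ∀ (N : ℕ) (p : Fin n → ℂ[X]),
      (∑ j, (p j).natDegree + (Finset.univ.filter fun j => p j ≠ 0).card) = N →
      (∀ k : ℕ, ∑ j, (p j).eval (k : ℂ) * lam j ^ k = 0) → ∀ j, p j = 0 from H _ p rfl h
  intro N
  induction N using Nat.strong_induction_on with
  | _ N ih =>
  intro p hN hp
  by_contra hne
  push Not at hne
  obtain ⟨j₀, hj₀⟩ := hne
  have hX : (X + C (1 : ℂ)).natDegree ≠ 0 := by
    rw [natDegree_X_add_C]
    exact one_ne_zero
  -- the differenced family `f(k+1) - λ_{j₀} f(k)`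
  set p' : Fin n → ℂ[X] := fun j => C (lam j) * (p j).comp (X + C 1) - C (lam j₀) * p j with hp'd
  have hp' : ∀ k : ℕ, ∑ j, (p' j).eval (k : ℂ) * lam j ^ k = 0 := by
    intro k
    have h1 := hp (k + 1)
    have h2 := hp k
    have e : ∑ j, (p' j).eval (k : ℂ) * lam j ^ k =
        ∑ j, (p j).eval (((k + 1 : ℕ) : ℂ)) * lam j ^ (k + 1) -
          lam j₀ * ∑ j, (p j).eval (k : ℂ) * lam j ^ k := by
      rw [Finset.mul_sum, ← Finset.sum_sub_distrib]
      refine Finset.sum_congr rfl fun j _ => ?_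
      simp only [hp'd, eval_sub, eval_mul, eval_C, eval_comp, eval_add, eval_X, Nat.cast_succ,
        pow_succ]
      ring
    rw [e, h1, h2, mul_zero, sub_zero]
  have hdeg : ∀ j, (p' j).natDegree ≤ (p j).natDegree := by
    intro j
    refine (natDegree_sub_le _ _).trans (max_le ?_ ?_)
    · refine (natDegree_C_mul_le _ _).trans ?_
      rw [natDegree_comp, natDegree_X_add_C, mul_one]
    · exact natDegree_C_mul_le _ _
  have hzero : ∀ j, p j = 0 → p' j = 0 := by
    intro j hj
    simp [hp'd, hj]
  have hdrop : p' j₀ = 0 ∨ (p' j₀).natDegree < (p j₀).natDegree := by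
    by_cases hz : p' j₀ = 0
    · exact Or.inl hz
    right
    refine natDegree_lt_natDegree hz ?_
    have hlc : ((p j₀).comp (X + C 1)).leadingCoeff = (p j₀).leadingCoeff := by
      rw [leadingCoeff_comp hX, leadingCoeff_X_add_C, one_pow, mul_one]
    have hc0 : (p j₀).comp (X + C 1) ≠ 0 := by
      rw [← leadingCoeff_ne_zero, hlc, leadingCoeff_ne_zero]
      exact hj₀
    have hd : ((p j₀).comp (X + C 1)).degree = (p j₀).degree := by
      rw [degree_eq_natDegree hc0, degree_eq_natDegree hj₀, natDegree_comp, natDegree_X_add_C,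
        mul_one]
    have e : p' j₀ = C (lam j₀) * ((p j₀).comp (X + C 1) - p j₀) := by
      simp only [hp'd]
      ring
    rw [e, degree_C_mul (h0 j₀), ← hd]
    exact degree_sub_lt hd hc0 hlc
  -- the measure drops
  have hsub : (Finset.univ.filter fun j => p' j ≠ 0) ⊆ Finset.univ.filter fun j => p j ≠ 0 := by
    intro j
    simp only [Finset.mem_filter, Finset.mem_univ, true_and]
    exact fun h1 h2 => h1 (hzero j h2)
  have hlt : (∑ j, (p' j).natDegree + (Finset.univ.filter fun j => p' j ≠ 0).card) < N := by
    rw [← hN]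
    rcases hdrop with hz | hlt'
    · have hcard : (Finset.univ.filter fun j => p' j ≠ 0).card <
          (Finset.univ.filter fun j => p j ≠ 0).card := by
        apply Finset.card_lt_card
        refine (Finset.ssubset_iff_of_subset hsub).mpr ⟨j₀, ?_, ?_⟩
        · simpa using hj₀
        · simp [hz]
      have hsum : ∑ j, (p' j).natDegree ≤ ∑ j, (p j).natDegree :=
        Finset.sum_le_sum fun j _ => hdeg j
      omega
    · have hsum : ∑ j, (p' j).natDegree < ∑ j, (p j).natDegree :=
        Finset.sum_lt_sum (fun j _ => hdeg j) ⟨j₀, Finset.mem_univ _, hlt'⟩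
      have hcard := Finset.card_le_card hsub
      omega
  have hall : ∀ j, p' j = 0 := ih _ hlt p' rfl hp'
  -- every `p j`, `j ≠ j₀`, vanishes (compare leading coefficients)
  have hj : ∀ j, j ≠ j₀ → p j = 0 := by
    intro j hjne
    by_contra hpj
    have e : C (lam j) * (p j).comp (X + C 1) = C (lam j₀) * p j := sub_eq_zero.mp (hall j)
    have e2 := congrArg leadingCoeff e
    rw [leadingCoeff_mul, leadingCoeff_mul, leadingCoeff_C, leadingCoeff_C, leadingCoeff_comp hX,
      leadingCoeff_X_add_C, one_pow, mul_one] at e2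
    have : lam j = lam j₀ := mul_right_cancel₀ (leadingCoeff_ne_zero.mpr hpj) e2
    exact hjne (hinj this)
  -- hence `p j₀` has infinitely many roots
  apply hj₀
  apply eq_zero_of_infinite_isRoot
  refine Set.Infinite.mono ?_ (Set.infinite_range_of_injective (Nat.cast_injective (R := ℂ)))
  rintro _ ⟨k, rfl⟩
  have hk := hp k
  rw [Finset.sum_eq_single j₀ (fun j _ hjne => by rw [hj j hjne, eval_zero, zero_mul])
    (fun h => (h (Finset.mem_univ _)).elim)] at hk
  simp only [Set.mem_setOf_eq, IsRoot.def]
  exact (mul_eq_zero.mp hk).resolve_right (pow_ne_zero _ (h0 j₀))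

/-! ### 2. Shear–twist orbits -/

/-- **Orbit lemma.** If a rational polynomial vanishes at the points `(u^k y, x + k a)`, `k ∈ ℕ`,
with `y ≠ 0` and `u ≠ 0` of infinite order, then it vanishes on the whole line `ℂ × {x}`
(expand in the first variable: an exponential polynomial in `k` with frequencies `u^i`).
[this file] -/
theorem aeval_line_eq_zero_of_shear_twist_orbit {x y a u : ℂ} (hy0 : y ≠ 0) (hu0 : u ≠ 0)
    (hroot : ∀ n : ℕ, 0 < n → u ^ n ≠ 1) (P : MvPolynomial (Fin 2) ℚ)
    (hP : ∀ k : ℕ, MvPolynomial.aeval ![u ^ k * y, x + k * a] P = 0) (y' : ℂ) :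
    MvPolynomial.aeval ![y', x] P = 0 := by
  classical
  -- base change to `ℂ` and split off the first variable
  set P' : MvPolynomial (Fin 2) ℂ := MvPolynomial.map (algebraMap ℚ ℂ) P with hP'
  set Q : Polynomial (MvPolynomial (Fin 1) ℂ) := MvPolynomial.finSuccEquiv ℂ 1 P' with hQ
  have hev : ∀ v : Fin 2 → ℂ, MvPolynomial.aeval v P = MvPolynomial.eval v P' := by
    intro v
    rw [hP', MvPolynomial.eval_map, MvPolynomial.aeval_def]
  have hsplit : ∀ b c : ℂ, MvPolynomial.eval ![b, c] P' =
      Polynomial.eval b (Polynomial.map (MvPolynomial.eval ![c]) Q) :=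
    fun b c => MvPolynomial.eval_eq_eval_mv_eval' ![c] b P'
  -- the substitution `X₀ ↦ x + a·T`
  have hG : ∀ (q : MvPolynomial (Fin 1) ℂ) (t : ℂ),
      (MvPolynomial.aeval (fun _ : Fin 1 => Polynomial.C x + Polynomial.C a * Polynomial.X)
        q).eval t = MvPolynomial.eval ![x + t * a] q := by
    intro q t
    induction q using MvPolynomial.induction_on with
    | C r => simp
    | add p q hp hq => simp only [map_add, Polynomial.eval_add, hp, hq]
    | mul_X p i hp =>
      rw [map_mul, Polynomial.eval_mul, hp, map_mul, MvPolynomial.aeval_X, MvPolynomial.eval_X,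
        Polynomial.eval_add, Polynomial.eval_mul, Polynomial.eval_C, Polynomial.eval_C,
        Polynomial.eval_X]
      congr 1
      fin_cases i
      simp [mul_comm]
  -- the exponential polynomial attached to `P`
  set D := Q.natDegree with hD
  set pp : Fin (D + 1) → ℂ[X] := fun i => Polynomial.C (y ^ (i : ℕ)) *
    MvPolynomial.aeval (fun _ : Fin 1 => Polynomial.C x + Polynomial.C a * Polynomial.X)
      (Q.coeff i) with hppd
  have hkey : ∀ i j : ℕ, i < j → u ^ i ≠ u ^ j := by
    intro i j hij hu
    have e : u ^ j = u ^ i * u ^ (j - i) := by rw [← pow_add, Nat.add_sub_cancel' hij.le]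
    rw [e] at hu
    have h1 : u ^ (j - i) = 1 := by
      have h2 : u ^ i * u ^ (j - i) = u ^ i * 1 := by rw [mul_one]; exact hu.symm
      exact mul_left_cancel₀ (pow_ne_zero _ hu0) h2
    exact hroot (j - i) (Nat.sub_pos_of_lt hij) h1
  have hlam_inj : Function.Injective fun i : Fin (D + 1) => u ^ (i : ℕ) := by
    intro i j hij
    simp only at hij
    apply Fin.ext
    by_contra hne
    rcases Nat.lt_or_gt_of_ne hne with hlt | hlt
    · exact hkey _ _ hlt hij
    · exact hkey _ _ hlt hij.symm
  have hlam0 : ∀ i : Fin (D + 1), u ^ (i : ℕ) ≠ 0 := fun i => pow_ne_zero _ hu0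
  have hsum : ∀ k : ℕ, ∑ i : Fin (D + 1), (pp i).eval (k : ℂ) * (u ^ (i : ℕ)) ^ k = 0 := by
    intro k
    have h1 := hP k
    have hlt : (Polynomial.map (MvPolynomial.eval ![x + (k : ℂ) * a]) Q).natDegree < D + 1 :=
      lt_of_le_of_lt (Polynomial.natDegree_map_le) (Nat.lt_succ_self _)
    rw [hev, hsplit, Polynomial.eval_eq_sum_range' hlt, Finset.sum_range] at h1
    rw [← h1]
    refine Finset.sum_congr rfl fun i _ => ?_
    rw [hppd, Polynomial.coeff_map, Polynomial.eval_mul, Polynomial.eval_C, hG]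
    ring
  have hpp : ∀ i, pp i = 0 := expPoly_eq_zero hlam_inj hlam0 pp hsum
  -- hence every coefficient of `Q` vanishes at `t = 0`
  have hcoef : ∀ i : ℕ, MvPolynomial.eval ![x] (Q.coeff i) = 0 := by
    intro i
    by_cases hi : i < D + 1
    · have h2 : MvPolynomial.aeval
          (fun _ : Fin 1 => Polynomial.C x + Polynomial.C a * Polynomial.X) (Q.coeff i) = 0 := by
        have := hpp ⟨i, hi⟩
        simpa [hppd, hy0] using this
      have h3 := hG (Q.coeff i) 0
      rw [h2, Polynomial.eval_zero] at h3
      simpa using h3.symm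
    · push Not at hi
      rw [Polynomial.coeff_eq_zero_of_natDegree_lt (by omega), map_zero]
  have hmap : Polynomial.map (MvPolynomial.eval ![x]) Q = 0 := by
    ext i
    rw [Polynomial.coeff_map, hcoef, Polynomial.coeff_zero]
  rw [hev, hsplit, hmap, Polynomial.eval_zero]

/-- **Shear–twist ⟹ algebraic independence.** If an endomorphism `φ` of `ℂ` translates `x` by a
`φ`-fixed `a` (possibly `0`) and multiplies `y ≠ 0` by a `φ`-fixed `u` of infinite order, and `x`
has one algebraically independent partner `w`, then `y, x` are algebraically independent.
[this file] -/
theorem algebraicIndependent_of_shear_twist (φ : ℂ →+* ℂ) {x y a u w : ℂ} (hx : φ x = x + a)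
    (ha : φ a = a) (hy : φ y = u * y) (hu : φ u = u) (hy0 : y ≠ 0)
    (hroot : ∀ n : ℕ, 0 < n → u ^ n ≠ 1) (hw : AlgebraicIndependent ℚ ![w, x]) :
    AlgebraicIndependent ℚ ![y, x] := by
  have hu0 : u ≠ 0 := by
    rintro rfl
    apply hy0
    have : φ y = 0 := by rw [hy, zero_mul]
    exact (map_eq_zero_iff φ φ.injective).mp this
  rw [algebraicIndependent_iff]
  intro P hP
  have horbit : ∀ k : ℕ, MvPolynomial.aeval ![u ^ k * y, x + k * a] P = 0 := by
    intro k
    induction k with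
    | zero => simpa using hP
    | succ k ih =>
      have h1 := congrArg φ ih
      rw [map_zero, ringHom_apply_aeval] at h1
      have e0 : φ (u ^ k * y) = u ^ (k + 1) * y := by
        rw [map_mul, map_pow, hu, hy, pow_succ]
        ring
      have e1 : φ (x + (k : ℂ) * a) = x + ((k + 1 : ℕ) : ℂ) * a := by
        rw [map_add, map_mul, map_natCast, hx, ha]
        push_cast
        ring
      have e : (fun i => φ (![u ^ k * y, x + (k : ℂ) * a] i)) =
          ![u ^ (k + 1) * y, x + ((k + 1 : ℕ) : ℂ) * a] := by
        funext i
        fin_cases i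
        · simpa using e0
        · simpa using e1
      rw [e] at h1
      exact h1
  have hline := aeval_line_eq_zero_of_shear_twist_orbit hy0 hu0 hroot P horbit
  exact (algebraicIndependent_iff.mp hw) P (hline w)

end Summit.Schanuel.Schanuel.Theorems
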